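import Summits.CriticalPhenomena.PercolationContinuityZ3.Theorems.PercNearOneGluingNoHeavyLowerTailSahiTripartitionUnionConditioned
import Mathlib
import HarnessLib
import HarnessLib.Audit.Tags

/-!
# `NoHeavyLowerTail` (crux stmt-CriticalPhenomena-4575), master-family line P1 (gen 18):
# the typed CHAIN conjecture — the one surviving polarisation of the tripartition ULC lemma — and its kernel reduction to both halves

Support file (seat `prim-masterthm-p1`, gen 18; `--supports stmt-CriticalPhenomena-4575`), on top of
`…SahiTripartitionUnionConditioned` (gen 18: `pairCount`, `twoCover`).  Memo
`run/shared/lean/prim/prim-masterthm/FROM-prim-masterthm-p1-g18-UNION-CONDITIONED.md` §0.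

SETTING.  Two-covers `(x, y)` of a twist set `t` (`x ∩ y ⊆ t ⊆ x ∪ y`; `t = ∅`: ordered tripartitions) with the THIRD CELL
`thirdCell t x y = ((x ∪ y) \\ t ∪ x ∩ y)ᶜ` (outside `t` the complement of the union, inside `t` the complement of the intersection:
the coordinates of `t` lie in exactly two of the three cells — the cells of a UNATE property `u (· △ t)` after untwisting).
`cellCount t P` counts the two-covers whose three cells pass `P`.
* **CONJECTURE CHAIN (`ChainTripartitionNC`, typed).**  For up-sets `u₂ ≤ u₁ ≤ c` and every `t`:
  `#{x∈u₁, y∈u₂, z∈c}·#{z∈c} ≤ #{x∈u₁, z∈c}·#{y∈u₂, z∈c}` — conditioning on the third cell lying in the TOP of the chain keeps the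
  other two cells negatively correlated.  CENSUS (exact, memo §0/§2): all 2 135 550 934 chains on 5 points for `t = ∅` (kit j201534),
  all 10 986 014 455 chains × type patterns `|t| = 1..5` on 5 points (kit j201814), all chains × all patterns on 4 points: 0 failures.
  SHARPNESS: every other polarisation is FALSE on 5 points — incomparable `u₁, u₂ ≤ c` (`u₁ = ad∨ace, u₂ = bc∨ace,
  c = ab∨ac∨bc∨ad∨cd∨e`: `11·11 < 1·139`), `u₁ ≤ c ≤ u₂` ("mid", 75 failures), `c ≤ u₂ ≤ u₁` ("above", already on 4 points), and
  the class-wise / sectional / real-monotone forms (memo §0).  Kahn–Neiman's CNA for threshold urns (RSA 2012) is the grading `|·|`.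
* KERNEL REDUCTION (this file): `halfA_of_chain` (u₁ = u₂ = c: given the third cell ∈ u, the first two are negatively correlated, every
  pattern) and **`halfB_of_chain`** (given the third cell ∉ u) via the COMPLEMENT DUALITY of the two-cover model — `x ↦ xᶜ` on all cells
  maps two-covers of `t` to two-covers of `tᶜ` (`twoCover_compl`), complements the third cell (`thirdCell_compl`), hence
  `cellCount tᶜ (P ∘ ᶜ) = cellCount t P` (`cellCount_compl`), and turns `u` into the dual property `u* x = ¬u xᶜ` (`dualProp`, monotone);
  plus inclusion–exclusion (`cellCount_split`).  So CHAIN ⟹ the tripartition ULC lemma (`SahiTripartition.UnateTripartitionULC`) in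
  cell-count form for every unate property; the identification of these cell counts with the tree's `nParts u c` for `u = v ∘ (· △ t)`
  (a bijection `(X,Y) ↦ (X △ t, Y △ t)` plus exchangeability of the cells) is left for a successor (memo §5).
HONEST FRAMING: a typed conjecture with kernel-checked reductions; CHAIN and the lemma remain OPEN. [this work]
-/

namespace Summit.CriticalPhenomena.PercolationContinuityZ3.Theorems

namespace SahiTripartition

open Finset

variable {ι : Type*} [Fintype ι] [DecidableEq ι]

/-! ### 1. The third cell, cell counts, and the conjecture -/

/-- The third cell of the two-cover model: outside `t` it is the complement of `x ∪ y`, inside `t` the complement of `x ∩ y`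
(coordinates of `t` lie in exactly two of the three cells). [this work] -/
def thirdCell (t x y : Finset ι) : Finset ι := ((x ∪ y) \ t ∪ x ∩ y)ᶜ

/-- For `t = ∅` the third cell is the complement of the union (ordered tripartitions). [this work] -/
theorem thirdCell_empty (x y : Finset ι) (h : Disjoint x y) : thirdCell ∅ x y = (x ∪ y)ᶜ := by
  simp [thirdCell, sdiff_empty, disjoint_iff_inter_eq_empty.mp h]

/-- Number of two-covers of `t` whose three cells pass the Boolean test `P`. [this work] -/
def cellCount (t : Finset ι) (P : Finset ι → Finset ι → Finset ι → Bool) : ℕ :=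
  ∑ x : Finset ι, ∑ y : Finset ι, if twoCover t x y = true ∧ P x y (thirdCell t x y) = true then 1 else 0

/-- `cellCount` with a test ignoring the third cell is `pairCount`. [this work] -/
theorem cellCount_eq_pairCount (t : Finset ι) (P : Finset ι → Finset ι → Bool) :
    cellCount t (fun x y _ => P x y) = pairCount (twoCover t) P := rfl

/-- **CONJECTURE CHAIN (typed; gen 18).**  For every type pattern `t` and up-sets `u₂ ≤ u₁ ≤ c` (a chain): conditioned on the
third cell lying in the TOP member `c`, the events "first cell ∈ u₁", "second cell ∈ u₂" are negatively correlated: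
`#{x∈u₁, y∈u₂, z∈c}·#{z∈c} ≤ #{x∈u₁, z∈c}·#{y∈u₂, z∈c}` over the two-covers of `t`.  `u₁ = u₂ = c`, all `t`: the tripartition
ULC lemma (`UnateTripartitionULC`, both halves, via the cube complement); `t = ∅`, `u₁ = u₂ = c`: Half A `n₂² ≥ 3n₁n₃`.  CENSUS (exact):
all 2 135 550 934 chains on 5 points (t = ∅, kit j201534), all chains × all 16 type patterns on 4 points; every non-nested / reversed
polarisation is FALSE on 5 points (memo g18 §0). [this work] [status: open] -/
@[conjecture] def ChainTripartitionNC : Prop :=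
  ∀ (n : ℕ) (t : Finset (Fin n)) (u₁ u₂ c : Finset (Fin n) → Bool), Monotone u₁ → Monotone u₂ → Monotone c →
    (∀ x, u₂ x = true → u₁ x = true) → (∀ x, u₁ x = true → c x = true) →
      cellCount t (fun x y z => u₁ x && u₂ y && c z) * cellCount t (fun _ _ z => c z) ≤
        cellCount t (fun x _ z => u₁ x && c z) * cellCount t (fun _ y z => u₂ y && c z)

/-- CHAIN specialised to one up-set (`u₁ = u₂ = c = u`): Half A in every type pattern, i.e. (with the complement duality) the
tripartition ULC lemma in cell-count form. [this work] -/
theorem halfA_of_chain (h : ChainTripartitionNC) (n : ℕ) (t : Finset (Fin n)) (u : Finset (Fin n) → Bool)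
    (hu : Monotone u) :
    cellCount t (fun x y z => u x && u y && u z) * cellCount t (fun _ _ z => u z) ≤
      cellCount t (fun x _ z => u x && u z) * cellCount t (fun _ y z => u y && u z) :=
  h n t u u u hu hu hu (fun _ hx => hx) (fun _ hx => hx)

/-! ### 2. Complement duality of the two-cover model; Half B from CHAIN -/

/-- Complementation as a permutation of `Finset ι`. [this work] -/
def complEquiv : Finset ι ≃ Finset ι where
  toFun x := xᶜ
  invFun x := xᶜ
  left_inv x := compl_compl x
  right_inv x := compl_compl x

/-- The dual Boolean property `u* x = ¬ u xᶜ`. [this work] -/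
def dualProp (u : Finset ι → Bool) : Finset ι → Bool := fun x => !u xᶜ

/-- The dual of a monotone property is monotone. [this work] -/
theorem monotone_dualProp {u : Finset ι → Bool} (hu : Monotone u) : Monotone (dualProp u) := by
  intro x y hxy
  unfold dualProp
  have h : u yᶜ ≤ u xᶜ := hu (compl_subset_compl.mpr hxy)
  revert h
  cases u yᶜ <;> cases u xᶜ <;> simp

/-- Complementing all cells swaps the type of every coordinate: two-covers of `tᶜ` ↔ two-covers of `t`. [this work] -/
theorem twoCover_compl (t x y : Finset ι) : twoCover tᶜ xᶜ yᶜ = twoCover t x y := by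
  unfold twoCover
  apply decide_eq_decide.mpr
  rw [← compl_union, ← compl_inter, compl_subset_compl, compl_subset_compl]
  exact and_comm

/-- The third cell of the complemented pair is the complement of the third cell. [this work] -/
theorem thirdCell_compl (t x y : Finset ι) : thirdCell tᶜ xᶜ yᶜ = (thirdCell t x y)ᶜ := by
  ext j
  simp only [thirdCell, mem_compl, mem_union, mem_sdiff, mem_inter, not_or, not_and, not_not]
  tauto

/-- **Complement duality of cell counts**: counting two-covers of `tᶜ` through complemented cells = counting two-covers of `t`.
[this work] -/
theorem cellCount_compl (t : Finset ι) (P : Finset ι → Finset ι → Finset ι → Bool) :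
    cellCount tᶜ (fun x y z => P xᶜ yᶜ zᶜ) = cellCount t P := by
  unfold cellCount
  rw [← (complEquiv (ι := ι)).sum_comp]
  refine Fintype.sum_congr _ _ fun x => ?_
  rw [← (complEquiv (ι := ι)).sum_comp]
  refine Fintype.sum_congr _ _ fun y => ?_
  show (if twoCover tᶜ xᶜ yᶜ = true ∧ P xᶜᶜ yᶜᶜ (thirdCell tᶜ xᶜ yᶜ)ᶜ = true then 1 else 0) = _
  rw [twoCover_compl, thirdCell_compl, compl_compl, compl_compl, compl_compl]

/-- Cell counts only depend on the test pointwise. [this work] -/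
theorem cellCount_congr (t : Finset ι) {P P' : Finset ι → Finset ι → Finset ι → Bool}
    (h : ∀ x y z, P x y z = P' x y z) : cellCount t P = cellCount t P' := by
  rw [show P = P' from funext fun x => funext fun y => funext fun z => h x y z]

/-- Additivity of cell counts: splitting a test by a second test. [this work] -/
theorem cellCount_split (t : Finset ι) (P Q : Finset ι → Finset ι → Finset ι → Bool) :
    cellCount t (fun x y z => P x y z && Q x y z) + cellCount t (fun x y z => P x y z && !Q x y z) =
      cellCount t P := by
  unfold cellCount
  rw [← sum_add_distrib]
  refine Fintype.sum_congr _ _ fun x => ?_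
  rw [← sum_add_distrib]
  refine Fintype.sum_congr _ _ fun y => ?_
  rcases hT : twoCover t x y with _ | _ <;> rcases hP : P x y (thirdCell t x y) with _ | _ <;>
    rcases hQ : Q x y (thirdCell t x y) with _ | _ <;> simp [hP, hQ]

/-- **Half B from CHAIN.**  For monotone `u` and every type pattern `t`: conditioned on the third cell NOT lying in `u`, the first two
cells are negatively correlated — obtained from `halfA_of_chain` for the dual property `u*` in the complementary type pattern `tᶜ`
(the cube complement swaps "exactly one cell" and "exactly two cells") and inclusion–exclusion. Together with `halfA_of_chain` this is
the tripartition ULC lemma (`UnateTripartitionULC`) in cell-count form, conditional on CHAIN. [this work] -/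
theorem halfB_of_chain (h : ChainTripartitionNC) (n : ℕ) (t : Finset (Fin n)) (u : Finset (Fin n) → Bool)
    (hu : Monotone u) :
    cellCount t (fun x y z => u x && u y && !u z) * cellCount t (fun _ _ z => !u z) ≤
      cellCount t (fun x _ z => u x && !u z) * cellCount t (fun _ y z => u y && !u z) := by
  have hv : Monotone (dualProp u) := monotone_dualProp hu
  -- rewrite every count of the goal as a count in pattern tᶜ through complemented cells
  have e1 : cellCount t (fun x y z => u x && u y && !u z) =
      cellCount tᶜ (fun x y z => !dualProp u x && !dualProp u y && dualProp u z) := by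
    rw [← cellCount_compl t]; simp only [dualProp, Bool.not_not]
  have e2 : cellCount t (fun _ _ z => !u z) = cellCount tᶜ (fun _ _ z => dualProp u z) := by
    rw [← cellCount_compl t]; simp only [dualProp]
  have e3 : cellCount t (fun x _ z => u x && !u z) =
      cellCount tᶜ (fun x _ z => !dualProp u x && dualProp u z) := by
    rw [← cellCount_compl t]; simp only [dualProp, Bool.not_not]
  have e4 : cellCount t (fun _ y z => u y && !u z) =
      cellCount tᶜ (fun _ y z => !dualProp u y && dualProp u z) := by
    rw [← cellCount_compl t]; simp only [dualProp, Bool.not_not]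
  rw [e1, e2, e3, e4]
  generalize tᶜ = s
  generalize hvd : dualProp u = v
  rw [hvd] at hv
  -- Half A for v in pattern s
  have hA : cellCount s (fun x y z => v x && v y && v z) * cellCount s (fun _ _ z => v z) ≤
      cellCount s (fun x _ z => v x && v z) * cellCount s (fun _ y z => v y && v z) := halfA_of_chain h n s v hv
  -- inclusion–exclusion identities (all from `cellCount_split` + `cellCount_congr`)
  have i1 : cellCount s (fun x _ z => v x && v z) + cellCount s (fun x _ z => !v x && v z) = cellCount s (fun _ _ z => v z) := by
    have h0 := cellCount_split s (fun _ _ z => v z) (fun x _ _ => v x)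
    have ea : cellCount s (fun x y z => (fun _ _ z => v z) x y z && (fun x _ _ => v x) x y z) = cellCount s (fun x _ z => v x && v z) :=
      cellCount_congr s (by intro x y z; dsimp only; cases v x <;> cases v y <;> cases v z <;> rfl)
    have eb : cellCount s (fun x y z => (fun _ _ z => v z) x y z && !(fun x _ _ => v x) x y z) = cellCount s (fun x _ z => !v x && v z) :=
      cellCount_congr s (by intro x y z; dsimp only; cases v x <;> cases v y <;> cases v z <;> rfl)
    rw [ea, eb] at h0
    exact h0
  have i2 : cellCount s (fun x y z => v x && v y && v z) + cellCount s (fun x y z => !v x && v y && v z) = cellCount s (fun _ y z => v y && v z) := by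
    have h0 := cellCount_split s (fun _ y z => v y && v z) (fun x _ _ => v x)
    have ea : cellCount s (fun x y z => (fun _ y z => v y && v z) x y z && (fun x _ _ => v x) x y z) = cellCount s (fun x y z => v x && v y && v z) :=
      cellCount_congr s (by intro x y z; dsimp only; cases v x <;> cases v y <;> cases v z <;> rfl)
    have eb : cellCount s (fun x y z => (fun _ y z => v y && v z) x y z && !(fun x _ _ => v x) x y z) = cellCount s (fun x y z => !v x && v y && v z) :=
      cellCount_congr s (by intro x y z; dsimp only; cases v x <;> cases v y <;> cases v z <;> rfl)
    rw [ea, eb] at h0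
    exact h0
  have i3 : cellCount s (fun x y z => !v x && v y && v z) + cellCount s (fun x y z => !v x && !v y && v z) = cellCount s (fun x _ z => !v x && v z) := by
    have h0 := cellCount_split s (fun x _ z => !v x && v z) (fun _ y _ => v y)
    have ea : cellCount s (fun x y z => (fun x _ z => !v x && v z) x y z && (fun _ y _ => v y) x y z) = cellCount s (fun x y z => !v x && v y && v z) :=
      cellCount_congr s (by intro x y z; dsimp only; cases v x <;> cases v y <;> cases v z <;> rfl)
    have eb : cellCount s (fun x y z => (fun x _ z => !v x && v z) x y z && !(fun _ y _ => v y) x y z) = cellCount s (fun x y z => !v x && !v y && v z) :=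
      cellCount_congr s (by intro x y z; dsimp only; cases v x <;> cases v y <;> cases v z <;> rfl)
    rw [ea, eb] at h0
    exact h0
  have i4 : cellCount s (fun x y z => v x && !v y && v z) + cellCount s (fun x y z => !v x && !v y && v z) = cellCount s (fun _ y z => !v y && v z) := by
    have h0 := cellCount_split s (fun _ y z => !v y && v z) (fun x _ _ => v x)
    have ea : cellCount s (fun x y z => (fun _ y z => !v y && v z) x y z && (fun x _ _ => v x) x y z) = cellCount s (fun x y z => v x && !v y && v z) :=
      cellCount_congr s (by intro x y z; dsimp only; cases v x <;> cases v y <;> cases v z <;> rfl)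
    have eb : cellCount s (fun x y z => (fun _ y z => !v y && v z) x y z && !(fun x _ _ => v x) x y z) = cellCount s (fun x y z => !v x && !v y && v z) :=
      cellCount_congr s (by intro x y z; dsimp only; cases v x <;> cases v y <;> cases v z <;> rfl)
    rw [ea, eb] at h0
    exact h0
  have i5 : cellCount s (fun x y z => v x && v y && v z) + cellCount s (fun x y z => v x && !v y && v z) = cellCount s (fun x _ z => v x && v z) := by
    have h0 := cellCount_split s (fun x _ z => v x && v z) (fun _ y _ => v y)
    have ea : cellCount s (fun x y z => (fun x _ z => v x && v z) x y z && (fun _ y _ => v y) x y z) = cellCount s (fun x y z => v x && v y && v z) :=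
      cellCount_congr s (by intro x y z; dsimp only; cases v x <;> cases v y <;> cases v z <;> rfl)
    have eb : cellCount s (fun x y z => (fun x _ z => v x && v z) x y z && !(fun _ y _ => v y) x y z) = cellCount s (fun x y z => v x && !v y && v z) :=
      cellCount_congr s (by intro x y z; dsimp only; cases v x <;> cases v y <;> cases v z <;> rfl)
    rw [ea, eb] at h0
    exact h0
  -- arithmetic in ℤ:  N = a + abar, b = c + m, abar = m + d, bbar = m' + d, a = c + m', c N ≤ a b  ⊢  d N ≤ abar bbar
  zify at hA i1 i2 i3 i4 i5 ⊢
  nlinarith [hA, i1, i2, i3, i4, i5]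

end SahiTripartition

end Summit.CriticalPhenomena.PercolationContinuityZ3.Theorems
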